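import Literature.Analysis.FluidPDE.TaoLocalisationContinuation
import Literature.Analysis.FluidPDE.TaoH1AlmostRegular
import Literature.Analysis.FluidPDE.TaoBoundedTotalSpeed
import HarnessLib

/-!
# Tao (2011/2013), Prop. 9.1 and Thm. 10.1 by continuation from `H¹` data: the bounded total
# speed of finite energy classical solutions without Littlewood–Paley theory

Fifth layer of the decomposition of Tao 2011, Thm. 10.1 in the exterior form of Remark 10.6 at
unit viscosity (`tao2011_enstrophyLocalisation_exterior_unit`, `TaoUnitViscosity.lean`) and of the
Cor. 11.1 / Cor. 11.4 chain above it. After `TaoEnstrophyLocalisationParts`, `TaoUnitViscosity`,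
`TaoBoundedTotalSpeed` and `TaoEnstrophyLocalisationAnnulus` that fact rests on Lemma 8.1
(proved, `tao_finite_energy_smooth_energy_bound_holds`) and two open leaves of the printed proof:

* the **§10 a priori argument** (`tao2011_enstrophyLocalisation_exterior_apriori`, equivalently its
  annular unit-viscosity form `tao2011_enstrophyLocalisation_annulus_apriori_unit`), and
* **Prop. 9.1** (*bounded total speed*, arXiv:1108.1165, Prop. 52, p. 27:
  `‖u‖_{L¹_t L^∞_x([0,T] × ℝ³)} ≲ E^{1/2}T^{1/4} + E` for every finite energy almost smooth
  solution), whose printed proof (§9, pp. 27–28: Littlewood–Paley decomposition of the Duhamel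
  formula, frequency-localised heat decay, Bernstein, paraproduct trichotomy, Schur's test) is
  far from the tree (leaf `tao2011_duhamelNonlinearSpeed_unit`).

This file **proves Prop. 9.1 for the vendored class** — finite energy classical solutions on the
closed slab `[0, T] × ℝ³`, *datum merely smooth and in `L²`* — from the §10 a priori leaf and
**Tao's local `H¹` theory** (`tao2011_H1_local_almost_regular`, `TaoH1AlmostRegular.lean`:
Thm. 5.4 (i)–(ii) with Prop. 5.6, the almost regularity of the local `H¹` mild solution; a
standard leaf shared with the Ladyzhenskaya–Prodi–Serrin programme of the tree), thereby removing
the Littlewood–Paley leaf from the path to Thm. 10.1, Cor. 11.1 and Cor. 11.4: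

* `tao2011_boundedTotalSpeed_of_almostRegular_of_apriori :
    0 < c → TaoH1AlmostRegularWith c → tao2011_enstrophyLocalisation_exterior_apriori →
    tao2011_boundedTotalSpeed` (Prop. 9.1, every `ν > 0`, exactly as vendored), hence
* `tao2011_enstrophyLocalisation_exterior_unit_of_almostRegular_of_annulus :
    tao2011_H1_local_almost_regular → tao2011_enstrophyLocalisation_annulus_apriori_unit →
    tao2011_enstrophyLocalisation_exterior_unit` (the printed Thm. 10.1 at `ν = 1`, through the
  proved assembly `tao2011_enstrophyLocalisation_exterior_of_parts`), and likewise Prop. 9.1,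
  Cor. 11.1 (`tao2011_boundedEnstrophy`), Cor. 11.4 (`tao_unconditional_uniqueness` and its two
  variants) and `tao2011_hasBoundedSobolevNormsOn` from the same two leaves
  (`…_of_almostRegular_of_annulus`).

## The argument

`TaoLocalisationContinuation.lean` already runs the weak–strong continuation argument
(Robinson–Rodrigo–Sadowski 2016, proof of Lemma 6.11; Leray 1934, §§19–22) for *Schwartz* data,
where the solution is strong on closed initial segments `[0, s]` and Thm. 5.4 (ii)+(iv) for `H^∞`
data (`tao2011_smooth_local_existence`) restarts it. For Prop. 9.1 the datum is only in `L²`, and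
for Thm. 10.1 only in `H¹`; the present file therefore tracks strongness *away from zero* —
`u ∈ L^∞_t H^k_x([τ, s] × ℝ³)` for all `k` and all `0 < τ < s` — which is what Prop. 5.6 provides:

0. **Speed of solutions strong away from zero** (`lintegral_eLpNorm_top_le_of_strong_pos`): the
   proved Foias–Guillopé–Temam/Agmon bound for strong solutions
   (`tao2011_boundedTotalSpeed_of_hasBoundedSobolevNormsOn`, `NSStrongSpeedBound.lean`;
   Robinson–Rodrigo–Sadowski 2016, Lemma 8.15 + Thm. 8.17) applied to the translates `u(· + τ)`
   on `[0, T − τ]` and monotone convergence `(0, T) = ⋃ₙ (T/(n+2), T)` give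
   `∫₀ᵀ‖u‖_{L^∞} ≤ K(ν^{-3/4}E^{1/2}T^{1/4} + ν⁻²E)` whenever `ν∫₀ᵀ∫|∇u|² ≤ E`, with the absolute `K`
   of the strong-class theorem.
1. **Uniform `H¹` bound** (`exists_uniform_gradient_bound_of_strong_pos`): verbatim the bound of
   `TaoLocalisationContinuation.exists_uniform_gradient_bound` (a priori Thm. 10.1 on `[0, T']`,
   interior enstrophy by joint smoothness, Fourier step `tao2011_sobolev_of_vorticity_holds`), the
   speed budget now coming from step 0.
2. **Identification** (`hasBoundedSobolevNormsOn_after_of_almostRegular`): at a time `s` with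
   `‖u(s)‖²_{H¹} ≤ A` the almost regular local solution `v` from `u(s)` (Leray–Hopf, `C⁰_t H¹_x`,
   hence in the Serrin class `L^∞_t L⁶_x`; represented on `[τ, T₁]` by a classical solution with
   all Sobolev norms bounded) coincides with `u(· + s)` (a Leray–Hopf solution from the same datum:
   `isLerayHopfOn_of_finiteEnergy`, i.e. Lemma 8.1 + Lemma 4.1 (i), proved) by the proved
   Prodi–Serrin theorem `serrin_weak_strong_uniqueness_holds`; so `u` is strong on
   `[s + τ, s + T₁]` for every `τ > 0`, `A²T₁ ≤ cν³`.
3. **Induction** (`exists_strong_pos_initial`, `strong_pos_restart`,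
   `hasBoundedSobolevNormsOn_pos_of_H1`): from `H¹` data the initial segment is step 2 at `s = 0`;
   with the uniform `A` of step 1 each restart (at `s' = s − d` slightly before the current end
   `s`, so that the new strong interval `[s' + d/2, s' + T₁]` overlaps the old ones) advances the
   end by the fixed `cν³/(2(A² + 1))`, reaching `T`.
4. **`L²` data** (`hasBoundedSobolevNormsOn_pos_of_finiteEnergy`,
   `tao2011_boundedTotalSpeed_of_almostRegular_of_apriori`): by Lemma 8.1 `∫₀ᵀ∫|∇u|² < ∞`, so every
   `(0, σ)` contains a good time `τ` with `∇u(τ) ∈ L²` (`exists_mem_Ioo_lt_top_of_setLIntegral_lt_top`,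
   no measurability needed); step 3 for the translate `u(· + τ)` makes `u` strong on `[σ, T]`;
   step 0 with the dissipation budget `2 max(1, C₈.₁) E` of Lemma 8.1 gives Prop. 9.1 with
   `K(ν) = K(ν^{-3/4}(2c₈)^{1/2} + 2c₈ν⁻²) + 1` (for `E = 0` the solution vanishes by Lemma 8.1).

As Tao stresses (Remark 11.2) the closedness of the slab is essential; it enters through the
interior enstrophy bound of step 1. No statement of the tree is modified and no definition is
introduced; the two remaining leaves are reused, not restated.

## Mathlib / tree search

`lean search 'boundedTotalSpeed_of'`: the tree has `tao2011_boundedTotalSpeed_of_unit` (rescaling),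
`…_of_hasBoundedSobolevNormsOn` (strong class, proved) and `…_apriori_unit_of_duhamel`
(Littlewood–Paley leaf); no derivation of Prop. 9.1 for the finite energy class from the local
`H¹` theory. `lean search 'TaoH1AlmostRegularWith'`: stated in `TaoH1AlmostRegular.lean`, used only by
the Serrin programme (`NSSerrinRegularity.lean`). Reused: `TaoLocalisationContinuation`
(`lintegral_frobeniusNormSq_le_three_mul_iteratedFDeriv_one`, the pattern of
`exists_uniform_gradient_bound` and `hasBoundedSobolevNormsOn_restart`), `LerayH1Continuation`
(`memLqLp_top_six_of_isH1RegularOn_Icc`), `LerayHopfTranslate` (`setLIntegral_Ioo_comp_add_right`),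
`TaoFiniteEnergyLerayHopf` (`isLerayHopfOn_of_finiteEnergy`, `energyClass_of_finiteEnergy`,
`memLp_two_of_lintegral_lt_top`), `NSSerrinUniqueness` (`serrin_weak_strong_uniqueness_holds`),
`CheskidovShvydkoyRegular` (`eH1NormSq`, `eWeakGradL2Sq_le_of_hasWeakGradient`), `WholeSpaceIBP`
(`hasWeakGradient_fderiv_of_contDiff`), `VectorCalculus` (`IsDivFree.isWeaklyDivFree_holds`),
`EnstrophyGronwall` (`enorm_sq_fderiv_le_ofReal_frobeniusNormSq`), `ClassicalSolutionGlue`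
(`IsClassicalNSSolutionOn.comp_add_right`). Mathlib: `setLIntegral_iUnion_of_directed`,
`directed_of_isDirected_le`, `Continuous.ae_eq_iff_eq`, `lintegral_eq_zero_iff'`,
`setLIntegral_mono'`, `Real.volume_Ioo`.

## References

* T. Tao, *Localisation and compactness properties of the Navier–Stokes global regularity
  problem*, Anal. PDE 6 (2013) 25–107 = arXiv:1108.1165 (`Tao2011`): Prop. 9.1 (arXiv Prop. 52,
  p. 27) and its proof (§9, pp. 27–28), Thm. 10.1 with Remark 10.6 (Thm. 59, Rem. 64, pp. 30–33),
  Thm. 5.4 and Prop. 5.6 (Thm. 31, Prop. 33, pp. 18–19), Lemma 8.1 (Lemma 44, p. 24), Cor. 11.1 and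
  Remark 11.2 (Cor. 68, Rem. 69, p. 36), Cor. 11.4 (Cor. 71, p. 36).
* J. C. Robinson, J. L. Rodrigo, W. Sadowski, *The Three-Dimensional Navier–Stokes Equations:
  Classical Theory*, CUP 2016 (`RobinsonRodrigoSadowski2016`): proof of Lemma 6.11 (restart with a
  local strong solution + weak–strong uniqueness), Thm. 8.19 (weak–strong uniqueness), Lemma 8.15
  + Thm. 8.17 (the strong-class `L¹_t L^∞_x` bound).
* J. Leray, Acta Math. 63 (1934) (`Leray1934`), §§19–22 (continuation/restart).
-/

noncomputable section

open MeasureTheory Set Function Filter Topology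
open scoped ENNReal NNReal ContDiff

namespace Literature.Analysis.FluidPDE

/-! ## Small lemmas on the strong class `L^∞_t H^k_x` -/

/-- Bounded Sobolev norms on `[a, b]` and on `[b', c]` with `b' ≤ b` give bounded Sobolev norms on
`[a, c]` (maximum of the two constants). [folklore] -/
theorem HasBoundedSobolevNormsOn.union_Icc
    {u : ℝ → EuclideanSpace ℝ (Fin 3) → EuclideanSpace ℝ (Fin 3)} {a b b' c : ℝ}
    (h₁ : HasBoundedSobolevNormsOn (Icc a b) u) (h₂ : HasBoundedSobolevNormsOn (Icc b' c) u)
    (hb : b' ≤ b) : HasBoundedSobolevNormsOn (Icc a c) u := fun n => by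
  obtain ⟨C₁, hC₁⟩ := h₁ n
  obtain ⟨C₂, hC₂⟩ := h₂ n
  refine ⟨max C₁ C₂, fun t ht => ?_⟩
  rcases le_or_gt t b with htb | htb
  · exact (hC₁ t ⟨ht.1, htb⟩).trans (ENNReal.coe_le_coe.2 (le_max_left _ _))
  · exact (hC₂ t ⟨hb.trans htb.le, ht.2⟩).trans (ENNReal.coe_le_coe.2 (le_max_right _ _))

/-- Time translation of the strong class: bounds for `u` on `[a + s, b + s]` are bounds for
`u(· + s)` on `[a, b]`. [folklore] -/
theorem HasBoundedSobolevNormsOn.comp_add_right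
    {u : ℝ → EuclideanSpace ℝ (Fin 3) → EuclideanSpace ℝ (Fin 3)} {a b : ℝ} (s : ℝ)
    (h : HasBoundedSobolevNormsOn (Icc (a + s) (b + s)) u) :
    HasBoundedSobolevNormsOn (Icc a b) (fun t => u (t + s)) := fun n =>
  (h n).imp fun _ hC t ht => hC (t + s) ⟨by linarith [ht.1], by linarith [ht.2]⟩

/-- Time translation of the strong class, converse direction. [folklore] -/
theorem HasBoundedSobolevNormsOn.of_comp_add_right
    {u : ℝ → EuclideanSpace ℝ (Fin 3) → EuclideanSpace ℝ (Fin 3)} {a b : ℝ} (s : ℝ)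
    (h : HasBoundedSobolevNormsOn (Icc a b) (fun t => u (t + s))) :
    HasBoundedSobolevNormsOn (Icc (a + s) (b + s)) u := fun n =>
  (h n).imp fun _ hC t ht => by
    have h' := hC (t - s) ⟨by linarith [ht.1], by linarith [ht.2]⟩
    simpa only [sub_add_cancel] using h'

/-- Transfer of the strong class along equality of the slices on the time set. [folklore] -/
theorem HasBoundedSobolevNormsOn.congr
    {u v : ℝ → EuclideanSpace ℝ (Fin 3) → EuclideanSpace ℝ (Fin 3)} {S : Set ℝ}
    (h : HasBoundedSobolevNormsOn S v) (heq : ∀ t ∈ S, u t = v t) :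
    HasBoundedSobolevNormsOn S u := fun n =>
  (h n).imp fun _ hC t ht => by
    rw [heq t ht]
    exact hC t ht

/-- *Strong away from zero up to `s`* — `u ∈ L^∞_t H^k_x([τ, s] × ℝ³)` for all `k` and every
`0 < τ < s` (the regularity of Tao's almost regular `H¹` solutions, Prop. 5.6, transported to a
given classical solution) — is antitone in `s`. [folklore] -/
theorem hasBoundedSobolevNormsOn_pos_mono
    {u : ℝ → EuclideanSpace ℝ (Fin 3) → EuclideanSpace ℝ (Fin 3)} {s s' : ℝ}
    (h : ∀ ⦃τ : ℝ⦄, 0 < τ → τ < s → HasBoundedSobolevNormsOn (Icc τ s) u) (hs' : s' ≤ s) :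
    ∀ ⦃τ : ℝ⦄, 0 < τ → τ < s' → HasBoundedSobolevNormsOn (Icc τ s') u :=
  fun _τ hτ0 hτs' => by
  rcases lt_or_eq_of_le hs' with hlt | heq
  · exact (h hτ0 (hτs'.trans hlt)).mono (Icc_subset_Icc_right hs')
  · subst heq
    exact h hτ0 hτs'

/-- From strongness on every `[τ, T]`, `0 < τ < T`, to the closed intervals `[τ, T]`,
`0 < τ ≤ T` (the degenerate `[T, T]` included). [folklore] -/
theorem hasBoundedSobolevNormsOn_Icc_of_pos
    {u : ℝ → EuclideanSpace ℝ (Fin 3) → EuclideanSpace ℝ (Fin 3)} {T : ℝ}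
    (h : ∀ ⦃τ : ℝ⦄, 0 < τ → τ < T → HasBoundedSobolevNormsOn (Icc τ T) u) {τ : ℝ} (hτ0 : 0 < τ)
    (hτT : τ ≤ T) : HasBoundedSobolevNormsOn (Icc τ T) u := by
  rcases lt_or_eq_of_le hτT with hlt | heq
  · exact h hτ0 hlt
  · subst heq
    exact (h (half_pos hτ0) (half_lt_self hτ0)).mono
      (Icc_subset_Icc_left (half_le_self hτ0.le))

/-! ## Step 0: total speed of a classical solution that is strong away from `t = 0` -/

/-- **Bounded total speed for classical solutions that are strong on every `[τ, T]`, `τ > 0`.**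
The proved strong-class bound (Foias–Guillopé–Temam/Agmon,
`tao2011_boundedTotalSpeed_of_hasBoundedSobolevNormsOn`, constant `K`) applied to the translates
`u(· + τ)` on `[0, T − τ]` (the system is autonomous; the dissipation budget `E` on `[0, T]`
dominates that on `[τ, T]`) gives `∫_τ^T ‖u‖_{L^∞} ≤ K(ν^{-3/4}E^{1/2}T^{1/4} + ν⁻²E)` for every
`0 < τ < T`, and `(0, T) = ⋃ₙ (T/(n+2), T)` (monotone convergence) gives the same bound from `0`.
Nothing is assumed at `t = 0` beyond what the classical-solution predicate provides. [cite: RobinsonRodrigoSadowski2016, Lemma 8.15 + Thm. 8.17; Tao2011, Prop. 9.1 (statement)] -/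
theorem lintegral_eLpNorm_top_le_of_strong_pos :
    ∃ K : ℝ, 0 < K ∧
      ∀ ⦃ν : ℝ⦄ (_hν : 0 < ν) ⦃T : ℝ⦄ (_hT : 0 < T)
        ⦃u : ℝ → EuclideanSpace ℝ (Fin 3) → EuclideanSpace ℝ (Fin 3)⦄
        ⦃p : ℝ → EuclideanSpace ℝ (Fin 3) → ℝ⦄
        (_hsol : IsClassicalNSSolutionOn (Icc 0 T) ν 0 u p)
        (_hHB : ∀ ⦃τ : ℝ⦄, 0 < τ → τ < T → HasBoundedSobolevNormsOn (Icc τ T) u)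
        ⦃E : ℝ⦄ (_hE : 0 < E)
        (_hD : ENNReal.ofReal ν *
            ∫⁻ t in Ioo 0 T, ∫⁻ x, ENNReal.ofReal (frobeniusNormSq (fderiv ℝ (u t) x)) ≤
          ENNReal.ofReal E),
        ∫⁻ t in Ioo 0 T, eLpNorm (u t) ∞ volume ≤
          ENNReal.ofReal (K * (ν ^ (-(3 / 4 : ℝ)) * Real.sqrt E * T ^ (1 / 4 : ℝ) + ν⁻¹ ^ 2 * E)) := by
  obtain ⟨K, hK, hspeed⟩ := tao2011_boundedTotalSpeed_of_hasBoundedSobolevNormsOn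
  refine ⟨K, hK, ?_⟩
  intro ν hν T hT u p hsol hHB E hE hD
  -- the bound on `(τ, T)` for every `0 < τ < T`, by translation
  have hτ : ∀ ⦃τ : ℝ⦄, 0 < τ → τ < T → ∫⁻ t in Ioo τ T, eLpNorm (u t) ∞ volume ≤
      ENNReal.ofReal (K * (ν ^ (-(3 / 4 : ℝ)) * Real.sqrt E * T ^ (1 / 4 : ℝ) + ν⁻¹ ^ 2 * E)) := by
    intro τ hτ0 hτT
    have hT' : 0 < T - τ := by linarith
    have hsol' : IsClassicalNSSolutionOn (Icc 0 (T - τ)) ν 0 (fun t => u (t + τ))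
        (fun t => p (t + τ)) :=
      (hsol.comp_add_right τ).mono (fun t ht => ⟨by linarith [ht.1], by linarith [ht.2]⟩)
        (uniqueDiffOn_Icc hT')
    have hHB' : HasBoundedSobolevNormsOn (Icc 0 (T - τ)) (fun t => u (t + τ)) := by
      refine HasBoundedSobolevNormsOn.comp_add_right τ ?_
      rw [zero_add, sub_add_cancel]
      exact hHB hτ0 hτT
    have hD' : ENNReal.ofReal ν * ∫⁻ t in Ioo 0 (T - τ), ∫⁻ x,
        ENNReal.ofReal (frobeniusNormSq (fderiv ℝ (u (t + τ)) x)) ≤ ENNReal.ofReal E := by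
      rw [setLIntegral_Ioo_comp_add_right
        (fun t => ∫⁻ x, ENNReal.ofReal (frobeniusNormSq (fderiv ℝ (u t) x))) 0 (T - τ) τ,
        zero_add, sub_add_cancel]
      exact (mul_le_mul_right (lintegral_mono_set (Ioo_subset_Ioo_left hτ0.le)) _).trans hD
    have h := hspeed hν hT' hsol' hHB' hE hD'
    rw [setLIntegral_Ioo_comp_add_right (fun t => eLpNorm (u t) ∞ volume) 0 (T - τ) τ, zero_add,
      sub_add_cancel] at h
    refine h.trans (ENNReal.ofReal_le_ofReal ?_)
    have h14 : (T - τ) ^ (1 / 4 : ℝ) ≤ T ^ (1 / 4 : ℝ) :=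
      Real.rpow_le_rpow hT'.le (by linarith) (by norm_num)
    have hmon : ν ^ (-(3 / 4 : ℝ)) * Real.sqrt E * (T - τ) ^ (1 / 4 : ℝ) ≤
        ν ^ (-(3 / 4 : ℝ)) * Real.sqrt E * T ^ (1 / 4 : ℝ) :=
      mul_le_mul_of_nonneg_left h14 (by positivity)
    exact mul_le_mul_of_nonneg_left (by linarith) hK.le
  -- exhaustion of `(0, T)` by the intervals `(T/(n+2), T)`
  have hUnion : (⋃ n : ℕ, Ioo (T / (n + 2)) T) = Ioo 0 T := by
    ext t
    simp only [mem_iUnion, mem_Ioo]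
    constructor
    · rintro ⟨n, h1, h2⟩
      exact ⟨(by positivity : (0 : ℝ) < T / (n + 2)).trans h1, h2⟩
    · rintro ⟨h1, h2⟩
      obtain ⟨n, hn⟩ := exists_nat_gt (T / t)
      refine ⟨n, ?_, h2⟩
      have hn2 : T / t < (n : ℝ) + 2 := hn.trans (by linarith)
      rw [div_lt_iff₀ (by positivity)]
      rw [div_lt_iff₀ h1] at hn2
      linarith
  have hdir : Directed (· ⊆ ·) (fun n : ℕ => Ioo (T / (n + 2)) T) := by
    refine directed_of_isDirected_le fun m n hmn => Ioo_subset_Ioo_left ?_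
    exact div_le_div_of_nonneg_left hT.le (by positivity) (by exact_mod_cast Nat.add_le_add_right hmn 2)
  rw [← hUnion, setLIntegral_iUnion_of_directed _ hdir]
  exact iSup_le fun n => hτ (by positivity) (div_lt_self hT (by norm_cast; omega))

/-! ## Step 1: the uniform `H¹` bound on initial segments that are strong away from zero -/

/-- **Uniform gradient bound on initial segments strong away from zero** (the variant of
`exists_uniform_gradient_bound` needed for `H¹` data). Let `(u, p)` be a finite energy classical
solution on `[0, T] × ℝ³`, `ν > 0`, with `∇u(0) ∈ L²`, and assume the a priori Thm. 10.1
(`tao2011_enstrophyLocalisation_exterior_apriori`). There is `H < ∞` such that for every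
`T' ∈ (0, T]` with `u ∈ L^∞_t H^k_x([τ, T'] × ℝ³)` for all `k` and all `0 < τ < T'` one has
`∫ ‖Du(t)‖² ≤ H` for all `t ∈ [0, T']`: the total speed on `[0, T']` is within the budget
`M = K(ν^{-3/4}E^{1/2}T^{1/4} + ν⁻²E)` by `lintegral_eLpNorm_top_le_of_strong_pos` (this is
where Prop. 9.1 is replaced by the strong-class bound), the choices of `δ`, `r`, `R` are made once
for `[0, T]` as in Tao's proof of Cor. 11.1, the exterior enstrophy is bounded by the a priori
Thm. 10.1 on `[0, T']`, the interior enstrophy by joint smoothness on `[0, T] × B̄(0, R + r)`, and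
`∫‖Du‖² ≲ ∫|ω|²` by the proved Fourier step `tao2011_sobolev_of_vorticity_holds`. [cite: Tao2011, Cor. 11.1 (proof) + Thm. 10.1 + Prop. 9.1] -/
theorem exists_uniform_gradient_bound_of_strong_pos
    (hA : tao2011_enstrophyLocalisation_exterior_apriori)
    {ν T : ℝ} (hν : 0 < ν) (hT : 0 < T)
    {u : ℝ → EuclideanSpace ℝ (Fin 3) → EuclideanSpace ℝ (Fin 3)}
    {p : ℝ → EuclideanSpace ℝ (Fin 3) → ℝ}
    (hsol : IsClassicalNSSolutionOn (Icc 0 T) ν 0 u p)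
    (hfe : ∃ C : ℝ≥0∞, C < ⊤ ∧ ∀ t ∈ Icc 0 T, ∫⁻ x, ‖u t x‖ₑ ^ 2 ≤ C)
    (h₁ : ∫⁻ x, ‖iteratedFDeriv ℝ 1 (u 0) x‖ₑ ^ 2 < ⊤) :
    ∃ H : ℝ≥0∞, H < ⊤ ∧ ∀ ⦃T' : ℝ⦄, 0 < T' → T' ≤ T →
      (∀ ⦃τ : ℝ⦄, 0 < τ → τ < T' → HasBoundedSobolevNormsOn (Icc τ T') u) →
      ∀ t ∈ Icc 0 T', ∫⁻ x, ‖iteratedFDeriv ℝ 1 (u t) x‖ₑ ^ 2 ≤ H := by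
  obtain ⟨K, hK⟩ := tao2011_sobolev_of_vorticity_holds
  obtain ⟨KS, hKS, hspeed⟩ := lintegral_eLpNorm_top_le_of_strong_pos
  obtain ⟨c, C, A, hc, hC, hApos, hmain⟩ := hA hν
  have hsm : FluidPDE.IsSmoothSpaceTimeOn (Icc 0 T) u := hsol.smooth_velocity
  have hUD : UniqueDiffOn ℝ (Icc 0 T) := uniqueDiffOn_Icc hT
  have hu : ∀ t ∈ Icc 0 T, ContDiff ℝ ∞ (u t) := fun t ht => hsol.contDiff_velocity ht
  -- the energy class (Lemma 8.1), with a real parameter `E > 0`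
  obtain ⟨A₀, hA₀, hEt, hD, -⟩ := energyClass_of_finiteEnergy hsol hν hT hfe
  have hL2 : ∀ t ∈ Icc 0 T, ∫⁻ x, ‖u t x‖ₑ ^ 2 < ⊤ := fun t ht =>
    (hEt t ht).trans_lt (lt_top_iff_ne_top.2 hA₀)
  set E : ℝ := A₀.toReal + 1 with hEdef
  have hEpos : 0 < E := by positivity
  have hA₀E : A₀ ≤ ENNReal.ofReal E := by
    rw [hEdef, ENNReal.ofReal_add ENNReal.toReal_nonneg zero_le_one, ENNReal.ofReal_toReal hA₀]
    exact le_self_add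
  have hE2 : ENNReal.ofReal E ≤ ENNReal.ofReal (2 * E) := ENNReal.ofReal_le_ofReal (by linarith)
  have hEt' : ∀ t ∈ Icc 0 T, ∫⁻ x, ‖u t x‖ₑ ^ 2 ≤ ENNReal.ofReal (2 * E) := fun t ht =>
    (hEt t ht).trans (hA₀E.trans hE2)
  have hD' : ENNReal.ofReal ν *
      ∫⁻ t in Ioo 0 T, ∫⁻ x, ENNReal.ofReal (frobeniusNormSq (fderiv ℝ (u t) x)) ≤
        ENNReal.ofReal E := hD.trans hA₀E
  -- the total speed budget `M` (uniform in `T' ≤ T`)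
  have hν34 : 0 ≤ ν ^ (-(3 / 4 : ℝ)) := Real.rpow_nonneg hν.le _
  have hT14 : 0 ≤ T ^ (1 / 4 : ℝ) := Real.rpow_nonneg hT.le _
  set M : ℝ := KS * (ν ^ (-(3 / 4 : ℝ)) * Real.sqrt E * T ^ (1 / 4 : ℝ) + ν⁻¹ ^ 2 * E) with hMdef
  have hM0 : 0 ≤ M := by positivity
  -- the choice of `δ` (condition (10.2) on `[0, T]`)
  set δ : ℝ := min 1 (c / (T * (1 + Real.sqrt E))) with hδdef
  have hden : 0 < T * (1 + Real.sqrt E) := by positivity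
  have hδpos : 0 < δ := lt_min one_pos (div_pos hc hden)
  have hδ1 : δ ≤ 1 := min_le_left _ _
  have hsmall : δ ^ 4 * T + δ ^ 5 * Real.sqrt E * T ≤ c := by
    have h4 : δ ^ 4 ≤ δ := pow_le_of_le_one hδpos.le hδ1 (by norm_num)
    have h5 : δ ^ 5 ≤ δ := pow_le_of_le_one hδpos.le hδ1 (by norm_num)
    have hsq : 0 ≤ Real.sqrt E := Real.sqrt_nonneg _
    calc δ ^ 4 * T + δ ^ 5 * Real.sqrt E * T ≤ δ * T + δ * Real.sqrt E * T := by gcongr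
      _ = δ * (T * (1 + Real.sqrt E)) := by ring
      _ ≤ c / (T * (1 + Real.sqrt E)) * (T * (1 + Real.sqrt E)) := by
          gcongr; exact min_le_right _ _
      _ = c := div_mul_cancel₀ _ hden.ne'
  -- the choice of `r` (condition (10.3) in the a priori form)
  set r : ℝ := C * (E + M + δ⁻¹ ^ 2) + 1 with hrdef
  have hlarge : C * (E + M + δ⁻¹ ^ 2) < r := lt_add_one _
  have hrpos : 0 < r := by
    have : 0 ≤ C * (E + M + δ⁻¹ ^ 2) := by positivity
    linarith
  -- the choice of `R`: small exterior initial enstrophy (monotone convergence)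
  have hcurl0 : ∫⁻ x, ‖FluidPDE.curl (u 0) x‖ₑ ^ 2 < ⊤ :=
    (lintegral_curl_sq_le (u 0)).trans_lt (ENNReal.mul_lt_top ENNReal.ofReal_lt_top h₁)
  have hδ2 : (0 : ℝ≥0∞) < ENNReal.ofReal (δ ^ 2) := ENNReal.ofReal_pos.2 (by positivity)
  obtain ⟨R, hR2r, hω₀⟩ := exists_setLIntegral_compl_ball_le hcurl0 hδ2 (2 * r)
  have hrR : r < R / 2 := by linarith
  -- interior bound from joint smoothness on `[0, T] × B̄(0, R + r)`
  set ρ : ℝ := R + r with hρ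
  obtain ⟨M₁, hM₁⟩ := hsm.exists_bound_iteratedFDeriv isCompact_Icc hUD
    (isCompact_closedBall (0 : EuclideanSpace ℝ (Fin 3)) ρ) 1
  set κ : ℝ := ‖FluidPDE.curlCLM‖ with hκ
  have hκ0 : 0 ≤ κ := by rw [hκ]; exact norm_nonneg FluidPDE.curlCLM
  have hcurl_pt : ∀ t ∈ Icc 0 T, ∀ x ∈ Metric.closedBall (0 : EuclideanSpace ℝ (Fin 3)) ρ,
      ‖FluidPDE.curl (u t) x‖ ≤ κ * M₁ := by
    intro t ht x hx
    refine (FluidPDE.norm_curl_le (u t) x).trans ?_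
    rw [← norm_iteratedFDeriv_one]
    exact mul_le_mul_of_nonneg_left (hM₁ t ht x hx) hκ0
  have hvol : volume (Metric.ball (0 : EuclideanSpace ℝ (Fin 3)) ρ) < ⊤ := measure_ball_lt_top
  set W₁ : ℝ≥0∞ :=
    ENNReal.ofReal ((κ * M₁) ^ 2) * volume (Metric.ball (0 : EuclideanSpace ℝ (Fin 3)) ρ) +
      ENNReal.ofReal ((A * δ) ^ 2) with hW₁
  have hW₁top : W₁ < ⊤ :=
    ENNReal.add_lt_top.2 ⟨ENNReal.mul_lt_top ENNReal.ofReal_lt_top hvol, ENNReal.ofReal_lt_top⟩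
  refine ⟨(K : ℝ≥0∞) * W₁, ENNReal.mul_lt_top ENNReal.coe_lt_top hW₁top, ?_⟩
  -- now an initial segment `[0, T']` strong away from zero
  intro T' hT' hT'T hHB t ht
  have hsub : Icc 0 T' ⊆ Icc 0 T := Icc_subset_Icc_right hT'T
  have hsol' : IsClassicalNSSolutionOn (Icc 0 T') ν 0 u p := hsol.mono hsub (uniqueDiffOn_Icc hT')
  -- dissipation on `[0, T']`
  have hD'' : ENNReal.ofReal ν *
      ∫⁻ t in Ioo 0 T', ∫⁻ x, ENNReal.ofReal (frobeniusNormSq (fderiv ℝ (u t) x)) ≤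
        ENNReal.ofReal E :=
    (mul_le_mul_right (lintegral_mono_set (Ioo_subset_Ioo_right hT'T)) _).trans hD'
  -- bounded total speed on `[0, T']` (strong away from zero), within the budget `M`
  have hMt : ∫⁻ t in Ioo 0 T', eLpNorm (u t) ∞ volume ≤ ENNReal.ofReal M := by
    refine (hspeed hν hT' hsol' hHB hEpos hD'').trans (ENNReal.ofReal_le_ofReal ?_)
    have h14 : T' ^ (1 / 4 : ℝ) ≤ T ^ (1 / 4 : ℝ) :=
      Real.rpow_le_rpow hT'.le hT'T (by norm_num)
    have hmon : ν ^ (-(3 / 4 : ℝ)) * Real.sqrt E * T' ^ (1 / 4 : ℝ) ≤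
        ν ^ (-(3 / 4 : ℝ)) * Real.sqrt E * T ^ (1 / 4 : ℝ) :=
      mul_le_mul_of_nonneg_left h14 (by positivity)
    rw [hMdef]
    exact mul_le_mul_of_nonneg_left (by linarith) hKS.le
  -- Thm. 10.1 (a priori form) on `[0, T']`
  have hsmall' : δ ^ 4 * T' + δ ^ 5 * Real.sqrt E * T' ≤ c := by
    refine le_trans ?_ hsmall
    have hsq : 0 ≤ Real.sqrt E := Real.sqrt_nonneg _
    gcongr
  obtain ⟨hext1, -⟩ := hmain hT' hsol' hEpos.le hM0 (fun s hs => hEt' s (hsub hs)) hD'' hMt 0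
    hδpos hrpos hrR hω₀ hsmall' hlarge
  -- gluing interior and exterior enstrophy at time `t`
  have hω : ∫⁻ x, ‖FluidPDE.curl (u t) x‖ₑ ^ 2 ≤ W₁ := by
    rw [← lintegral_add_compl _ (measurableSet_ball (x := (0 : EuclideanSpace ℝ (Fin 3))) (ε := ρ))]
    exact add_le_add (setLIntegral_ball_enorm_sq_le (hcurl_pt t (hsub ht))) (hext1 t ht)
  -- Fourier step
  exact ((hK (hu t (hsub ht)) (hsol.divFree t (hsub ht)) (hL2 t (hsub ht))).1).trans
    (mul_le_mul_right hω _)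

/-! ## Step 2: identification with Tao's almost regular local `H¹` solution -/

/-- **Strongness after a restart time, from the almost regular local `H¹` theory and
weak–strong uniqueness.** Let `(u, p)` be a finite energy classical solution on `[0, T] × ℝ³`,
`ν > 0`, and assume `TaoH1AlmostRegularWith c` (Tao 2011, Thm. 5.4 (i)–(ii) + Prop. 5.6). If
`0 ≤ s`, `s + T₁ ≤ T`, `‖u(s)‖²_{L²} + ‖∇u(s)‖²_{L²} ≤ A` and `A²T₁ ≤ cν³`, then
`u ∈ L^∞_t H^k_x([s + τ, s + T₁] × ℝ³)` for every `k` and every `0 < τ < T₁`: the datum `u(s)` is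
smooth, in `H¹` and (weakly) divergence free, so the almost regular local theory gives a
Leray–Hopf solution `v` on `[0, T₁)` from `u(s)`, `H¹`-continuous on `[0, T₁]` — hence in the
Serrin class `L^∞_t L⁶_x` (`H¹ ⊂ L⁶`) — and represented on every `[τ, T₁]` by a classical solution
`w` with all Sobolev norms bounded; the translate `u(· + s)` is a finite energy classical solution
on `[0, T₁]`, hence a Leray–Hopf solution from the same datum (`isLerayHopfOn_of_finiteEnergy`,
Lemma 8.1 + Lemma 4.1 (i)); by the proved Prodi–Serrin theorem
(`serrin_weak_strong_uniqueness_holds`) `u(t + s) = v(t) = w(t)` a.e., hence everywhere (continuous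
slices) for `t ∈ [τ, T₁]`, and the Sobolev bounds of `w` transfer to `u`
(Robinson–Rodrigo–Sadowski 2016, proof of Lemma 6.11). [cite: Tao2011, Thm. 5.4 (i)-(ii) and Prop. 5.6; RobinsonRodrigoSadowski2016, Lemma 6.11 (proof)] -/
theorem hasBoundedSobolevNormsOn_after_of_almostRegular {c : ℝ} (hreg : TaoH1AlmostRegularWith c)
    {ν T : ℝ} (hν : 0 < ν)
    {u : ℝ → EuclideanSpace ℝ (Fin 3) → EuclideanSpace ℝ (Fin 3)}
    {p : ℝ → EuclideanSpace ℝ (Fin 3) → ℝ}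
    (hsol : IsClassicalNSSolutionOn (Icc 0 T) ν 0 u p)
    (hfe : ∃ C : ℝ≥0∞, C < ⊤ ∧ ∀ t ∈ Icc 0 T, ∫⁻ x, ‖u t x‖ₑ ^ 2 ≤ C)
    {s : ℝ} (hs0 : 0 ≤ s) {A : ℝ} (hA : 0 ≤ A)
    (hH1 : (∫⁻ x, ‖u s x‖ₑ ^ 2) + (∫⁻ x, ENNReal.ofReal (frobeniusNormSq (fderiv ℝ (u s) x))) ≤
      ENNReal.ofReal A)
    {T₁ : ℝ} (hT₁ : 0 < T₁) (hsT₁ : s + T₁ ≤ T) (hsmall : A ^ 2 * T₁ ≤ c * ν ^ 3) :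
    ∀ ⦃τ : ℝ⦄, 0 < τ → τ < T₁ → HasBoundedSobolevNormsOn (Icc (s + τ) (s + T₁)) u := by
  intro τ hτ0 hτT₁
  -- the datum `u(s)`
  have hsI : s ∈ Icc 0 T := ⟨hs0, by linarith⟩
  have hus : ContDiff ℝ ∞ (u s) := hsol.contDiff_velocity hsI
  have hus1 : ContDiff ℝ 1 (u s) := contDiff_infty.1 hus 1
  have hL2s : ∫⁻ x, ‖u s x‖ₑ ^ 2 < ⊤ :=
    (le_self_add.trans hH1).trans_lt ENNReal.ofReal_lt_top
  have hu₀ : MemLp (u s) 2 volume := memLp_two_of_lintegral_lt_top hus.continuous hL2s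
  have hdiv : IsWeaklyDivFree (u s) :=
    VectorCalculus.IsDivFree.isWeaklyDivFree_holds (hsol.divFree s hsI) hus1
  have hH1' : eH1NormSq (u s) ≤ ENNReal.ofReal A := by
    rw [eH1NormSq_def]
    refine le_trans (add_le_add le_rfl
      (eWeakGradL2Sq_le_of_hasWeakGradient (hasWeakGradient_fderiv_of_contDiff hus1))) ?_
    exact hH1
  -- Tao's almost regular local solution `v` from `u(s)` on `[0, T₁]`
  obtain ⟨v, hLHv, hv0, hregv, hsmooth⟩ := hreg hν hT₁ hu₀ hdiv hA hH1' hsmall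
  -- the translate `u(· + s)` is a finite energy classical solution on `[0, T₁]`
  have hsolτ : IsClassicalNSSolutionOn (Icc 0 T₁) ν 0 (fun t => u (t + s)) (fun t => p (t + s)) :=
    (hsol.comp_add_right s).mono (fun t ht => ⟨by linarith [ht.1], by linarith [ht.2]⟩)
      (uniqueDiffOn_Icc hT₁)
  have hfeτ : ∃ C : ℝ≥0∞, C < ⊤ ∧ ∀ t ∈ Icc 0 T₁, ∫⁻ x, ‖u (t + s) x‖ₑ ^ 2 ≤ C := by
    obtain ⟨C, hC, hCt⟩ := hfe
    exact ⟨C, hC, fun t ht => hCt (t + s) ⟨by linarith [ht.1], by linarith [ht.2]⟩⟩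
  have hLHu : IsLerayHopfOn T₁ ν 0 (u s) (fun t => u (t + s)) := by
    have h := (isLerayHopfOn_of_finiteEnergy hsolτ hν hT₁ hfeτ).1
    simpa only [zero_add] using h
  -- weak–strong uniqueness in the Serrin class `L^∞_t L⁶_x`
  have hS : MemLqLp ∞ 6 v (Ioo 0 T₁) :=
    memLqLp_top_six_of_isH1RegularOn_Icc hregv fun t ht => hLHv.memLp t ht
  have hqr : 2 / (∞ : ℝ≥0∞) + 3 / 6 ≤ 1 := by
    rw [ENNReal.div_top, zero_add]
    exact ENNReal.div_le_of_le_mul (by norm_num)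
  have hWS : serrin_weak_strong_uniqueness := serrin_weak_strong_uniqueness_holds
  have hae : ∀ t ∈ Ioc 0 T₁, (fun t => u (t + s)) t =ᵐ[volume] v t :=
    hWS hν hT₁ hLHv hu₀ (q := ∞) (r := 6) (by norm_num) hqr hS hLHu
  -- the classical representative `w` of `v` on `[τ, T₁]`
  obtain ⟨w, π, hw, hHBw, -, -, hvw⟩ := hsmooth ⟨hτ0, hτT₁⟩
  have heq : ∀ t ∈ Icc τ T₁, u (t + s) = w t := by
    intro t ht
    have h1 : u (t + s) =ᵐ[volume] v t := hae t ⟨hτ0.trans_le ht.1, ht.2⟩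
    have h2 : u (t + s) =ᵐ[volume] w t := h1.trans (hvw t ht)
    have htI : t + s ∈ Icc 0 T := ⟨by linarith [ht.1], by linarith [ht.2]⟩
    exact (Continuous.ae_eq_iff_eq volume (hsol.contDiff_velocity htI).continuous
      (hw.contDiff_velocity ht).continuous).1 h2
  have hHBτ : HasBoundedSobolevNormsOn (Icc τ T₁) (fun t => u (t + s)) := hHBw.congr heq
  have h := HasBoundedSobolevNormsOn.of_comp_add_right s hHBτ
  rwa [add_comm τ s, add_comm T₁ s] at h

/-- **Initial segment.** Under `TaoH1AlmostRegularWith c` (`c > 0`), a finite energy classical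
solution on `[0, T] × ℝ³` with `∇u(0) ∈ L²` is strong away from zero up to some `T₀ ∈ (0, T]`
(`hasBoundedSobolevNormsOn_after_of_almostRegular` at `s = 0` with
`A = ‖u(0)‖²_{L²} + ‖∇u(0)‖²_{L²}`, `T₀ = min(cν³/(A² + 1), T)`). [cite: Tao2011, Thm. 5.4 (i)-(ii) and Prop. 5.6] -/
theorem exists_strong_pos_initial {c : ℝ} (hc : 0 < c) (hreg : TaoH1AlmostRegularWith c)
    {ν T : ℝ} (hν : 0 < ν) (hT : 0 < T)
    {u : ℝ → EuclideanSpace ℝ (Fin 3) → EuclideanSpace ℝ (Fin 3)}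
    {p : ℝ → EuclideanSpace ℝ (Fin 3) → ℝ}
    (hsol : IsClassicalNSSolutionOn (Icc 0 T) ν 0 u p)
    (hfe : ∃ C : ℝ≥0∞, C < ⊤ ∧ ∀ t ∈ Icc 0 T, ∫⁻ x, ‖u t x‖ₑ ^ 2 ≤ C)
    (h₁ : ∫⁻ x, ENNReal.ofReal (frobeniusNormSq (fderiv ℝ (u 0) x)) < ⊤) :
    ∃ T₀ : ℝ, 0 < T₀ ∧ T₀ ≤ T ∧
      ∀ ⦃τ : ℝ⦄, 0 < τ → τ < T₀ → HasBoundedSobolevNormsOn (Icc τ T₀) u := by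
  obtain ⟨C, hC, hCt⟩ := hfe
  have hL2 : ∫⁻ x, ‖u 0 x‖ₑ ^ 2 < ⊤ := (hCt 0 ⟨le_rfl, hT.le⟩).trans_lt hC
  set A₀ : ℝ≥0∞ := (∫⁻ x, ‖u 0 x‖ₑ ^ 2) +
    ∫⁻ x, ENNReal.ofReal (frobeniusNormSq (fderiv ℝ (u 0) x)) with hA₀def
  have hA₀top : A₀ ≠ ⊤ := (ENNReal.add_lt_top.2 ⟨hL2, h₁⟩).ne
  set A : ℝ := A₀.toReal with hAdef
  have hA : 0 ≤ A := ENNReal.toReal_nonneg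
  have hH1 : (∫⁻ x, ‖u 0 x‖ₑ ^ 2) +
      (∫⁻ x, ENNReal.ofReal (frobeniusNormSq (fderiv ℝ (u 0) x))) ≤ ENNReal.ofReal A := by
    rw [hAdef, ENNReal.ofReal_toReal hA₀top]
  set T₀ : ℝ := min (c * ν ^ 3 / (A ^ 2 + 1)) T with hT₀def
  have hτpos : 0 < c * ν ^ 3 / (A ^ 2 + 1) := by positivity
  have hT₀pos : 0 < T₀ := lt_min hτpos hT
  have hT₀T : T₀ ≤ T := min_le_right _ _
  have hsmall : A ^ 2 * T₀ ≤ c * ν ^ 3 :=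
    calc A ^ 2 * T₀ ≤ A ^ 2 * (c * ν ^ 3 / (A ^ 2 + 1)) := by gcongr; exact min_le_left _ _
      _ ≤ (A ^ 2 + 1) * (c * ν ^ 3 / (A ^ 2 + 1)) := by gcongr; linarith
      _ = c * ν ^ 3 := by field_simp
  refine ⟨T₀, hT₀pos, hT₀T, fun τ hτ0 hτT₀ => ?_⟩
  have h := hasBoundedSobolevNormsOn_after_of_almostRegular hreg hν hsol ⟨C, hC, hCt⟩ le_rfl hA
    hH1 hT₀pos (by rwa [zero_add]) hsmall hτ0 hτT₀
  rwa [zero_add, zero_add] at h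

/-- **Restart step.** Under `TaoH1AlmostRegularWith c` (`c > 0`), for a finite energy classical
solution on `[0, T] × ℝ³` and `A ≥ 0` put `τ₂ = cν³/(2(A² + 1))`. If `u` is strong away from zero
up to `s ∈ (0, T)` and `‖u(t)‖²_{L²} + ‖∇u(t)‖²_{L²} ≤ A` for all `t ∈ (0, s)`, then `u` is strong
away from zero up to `min(s + τ₂, T)`: restart at `s' = s − d`, `d = min(τ₂, s/2)`, where the `H¹`
bound holds, with lifespan `T₁ = min(2τ₂, T − s')` (`A²T₁ ≤ cν³`); the new strong interval
`[s' + d/2, s' + T₁]` overlaps the old ones `[τ, s]` and reaches `min(s + τ₂, T)`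
(Robinson–Rodrigo–Sadowski 2016, proof of Lemma 6.11; Leray 1934, §§20–22). [cite: RobinsonRodrigoSadowski2016, Lemma 6.11 (proof); Tao2011, Thm. 5.4 (i)-(ii) and Prop. 5.6] -/
theorem strong_pos_restart {c : ℝ} (hc : 0 < c) (hreg : TaoH1AlmostRegularWith c)
    {ν T : ℝ} (hν : 0 < ν)
    {u : ℝ → EuclideanSpace ℝ (Fin 3) → EuclideanSpace ℝ (Fin 3)}
    {p : ℝ → EuclideanSpace ℝ (Fin 3) → ℝ}
    (hsol : IsClassicalNSSolutionOn (Icc 0 T) ν 0 u p)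
    (hfe : ∃ C : ℝ≥0∞, C < ⊤ ∧ ∀ t ∈ Icc 0 T, ∫⁻ x, ‖u t x‖ₑ ^ 2 ≤ C) {A : ℝ} (hA : 0 ≤ A) :
    ∃ τ₂ : ℝ, 0 < τ₂ ∧ ∀ ⦃s : ℝ⦄, 0 < s → s < T →
      (∀ ⦃τ : ℝ⦄, 0 < τ → τ < s → HasBoundedSobolevNormsOn (Icc τ s) u) →
      (∀ t ∈ Ioo 0 s, (∫⁻ x, ‖u t x‖ₑ ^ 2) +
          (∫⁻ x, ENNReal.ofReal (frobeniusNormSq (fderiv ℝ (u t) x))) ≤ ENNReal.ofReal A) →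
      ∀ ⦃τ : ℝ⦄, 0 < τ → τ < min (s + τ₂) T →
        HasBoundedSobolevNormsOn (Icc τ (min (s + τ₂) T)) u := by
  set τ₂ : ℝ := c * ν ^ 3 / (2 * (A ^ 2 + 1)) with hτ₂
  have hτ₂pos : 0 < τ₂ := by positivity
  refine ⟨τ₂, hτ₂pos, fun s hs0 hsT hP hH1 => ?_⟩
  -- the restart time `s' = s - d`
  set d : ℝ := min τ₂ (s / 2) with hd
  have hdpos : 0 < d := lt_min hτ₂pos (half_pos hs0)
  have hdτ₂ : d ≤ τ₂ := min_le_left _ _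
  have hds : d < s := (min_le_right _ _).trans_lt (half_lt_self hs0)
  set s' : ℝ := s - d with hs'
  have hs'pos : 0 < s' := by rw [hs']; linarith
  have hs's : s' < s := by rw [hs']; linarith
  -- the lifespan `T₁ = min (2 τ₂) (T - s')`
  set T₁ : ℝ := min (2 * τ₂) (T - s') with hT₁
  have hT₁pos : 0 < T₁ := lt_min (by positivity) (by linarith)
  have hs'T₁ : s' + T₁ ≤ T := by
    have := min_le_right (2 * τ₂) (T - s')
    linarith
  have hsmall : A ^ 2 * T₁ ≤ c * ν ^ 3 :=
    calc A ^ 2 * T₁ ≤ A ^ 2 * (2 * τ₂) := by gcongr; exact min_le_left _ _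
      _ ≤ (A ^ 2 + 1) * (2 * τ₂) := by gcongr; linarith
      _ = c * ν ^ 3 := by rw [hτ₂]; field_simp
  have hstrong := hasBoundedSobolevNormsOn_after_of_almostRegular hreg hν hsol hfe hs'pos.le hA
    (hH1 s' ⟨hs'pos, hs's⟩) hT₁pos hs'T₁ hsmall
  -- the new piece `[s' + d/2, s' + T₁]`
  have hd2T₁ : d / 2 < T₁ := by
    refine lt_min (by linarith) ?_
    linarith
  have hpiece : HasBoundedSobolevNormsOn (Icc (s' + d / 2) (s' + T₁)) u :=
    hstrong (half_pos hdpos) hd2T₁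
  have hjoin : s' + d / 2 ≤ s := by rw [hs']; linarith
  -- strong away from zero up to `s' + T₁`
  have hP' : ∀ ⦃τ : ℝ⦄, 0 < τ → τ < s' + T₁ →
      HasBoundedSobolevNormsOn (Icc τ (s' + T₁)) u := by
    intro τ hτ0 hτlt
    rcases lt_or_ge τ s with hτs | hτs
    · exact (hP hτ0 hτs).union_Icc hpiece hjoin
    · exact hpiece.mono (Icc_subset_Icc_left (by linarith))
  -- and `min (s + τ₂) T ≤ s' + T₁`
  refine hasBoundedSobolevNormsOn_pos_mono hP' ?_
  rw [hT₁, hs']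
  rcases le_total (2 * τ₂) (T - (s - d)) with h | h
  · rw [min_eq_left h]
    refine (min_le_left _ _).trans ?_
    linarith
  · rw [min_eq_right h]
    refine (min_le_right _ _).trans ?_
    linarith

/-! ## Step 3: the induction — `H¹` data propagate strongness to `(0, T]` -/

/-- **Continuation theorem for `H¹` data.** Assume Tao's almost regular local `H¹` theory
(`TaoH1AlmostRegularWith c`, Thm. 5.4 (i)–(ii) + Prop. 5.6) and the a priori form of Thm. 10.1
(`tao2011_enstrophyLocalisation_exterior_apriori`). Then every finite energy classical solution
`(u, p)` of the unforced Navier–Stokes system on the closed slab `[0, T] × ℝ³`, `ν > 0`, whose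
datum has `∇u(0) ∈ L²` (an `H¹` datum; no higher regularity at `t = 0` is assumed) lies in
`L^∞_t H^k_x([τ, T] × ℝ³)` for every `k` and every `0 < τ < T`. Restart induction
(Robinson–Rodrigo–Sadowski 2016, proof of Lemma 6.11; Leray 1934, §§19–22): the initial segment
comes from the almost regular solution issued from `u(0)` (`exists_strong_pos_initial`); on an
initial segment strong away from zero the `H¹` norm is bounded by the uniform constant of
`exists_uniform_gradient_bound_of_strong_pos` (a priori Thm. 10.1, with Prop. 9.1 replaced by
the strong-class speed bound), so every restart advances strongness by the fixed step `τ₂`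
(`strong_pos_restart`). This is the regularity mechanism of Tao 2011, Cor. 11.1 for `H¹` data,
with the printed input Prop. 9.1 eliminated. [cite: Tao2011, Cor. 11.1 + Thm. 5.4 + Prop. 5.6 + Thm. 10.1; RobinsonRodrigoSadowski2016, Lemma 6.11 (proof)] -/
theorem hasBoundedSobolevNormsOn_pos_of_H1 {c : ℝ} (hc : 0 < c) (hreg : TaoH1AlmostRegularWith c)
    (hA : tao2011_enstrophyLocalisation_exterior_apriori)
    {ν T : ℝ} (hν : 0 < ν) (hT : 0 < T)
    {u : ℝ → EuclideanSpace ℝ (Fin 3) → EuclideanSpace ℝ (Fin 3)}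
    {p : ℝ → EuclideanSpace ℝ (Fin 3) → ℝ}
    (hsol : IsClassicalNSSolutionOn (Icc 0 T) ν 0 u p)
    (hfe : ∃ C : ℝ≥0∞, C < ⊤ ∧ ∀ t ∈ Icc 0 T, ∫⁻ x, ‖u t x‖ₑ ^ 2 ≤ C)
    (h₁ : ∫⁻ x, ‖iteratedFDeriv ℝ 1 (u 0) x‖ₑ ^ 2 < ⊤) :
    ∀ ⦃τ : ℝ⦄, 0 < τ → τ < T → HasBoundedSobolevNormsOn (Icc τ T) u := by
  obtain ⟨C, hC, hCt⟩ := hfe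
  have hfe : ∃ C : ℝ≥0∞, C < ⊤ ∧ ∀ t ∈ Icc 0 T, ∫⁻ x, ‖u t x‖ₑ ^ 2 ≤ C := ⟨C, hC, hCt⟩
  -- Step 1: the uniform gradient bound on initial segments strong away from zero
  obtain ⟨H, hHtop, hH⟩ := exists_uniform_gradient_bound_of_strong_pos hA hν hT hsol hfe h₁
  have h3H : 3 * H ≠ ⊤ := ENNReal.mul_ne_top (by simp) hHtop.ne
  -- the `H¹` budget at restart times
  set Ab : ℝ := C.toReal + (3 * H).toReal with hAbdef
  have hAb : 0 ≤ Ab := by positivity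
  have hbound : ∀ ⦃s : ℝ⦄, 0 < s → s ≤ T →
      (∀ ⦃τ : ℝ⦄, 0 < τ → τ < s → HasBoundedSobolevNormsOn (Icc τ s) u) → ∀ t ∈ Ioo 0 s,
      (∫⁻ x, ‖u t x‖ₑ ^ 2) + (∫⁻ x, ENNReal.ofReal (frobeniusNormSq (fderiv ℝ (u t) x))) ≤
        ENNReal.ofReal Ab := by
    intro s hs0 hsT hP t ht
    have hL2 : ∫⁻ x, ‖u t x‖ₑ ^ 2 ≤ C := hCt t ⟨ht.1.le, ht.2.le.trans hsT⟩
    have hgrad : ∫⁻ x, ENNReal.ofReal (frobeniusNormSq (fderiv ℝ (u t) x)) ≤ 3 * H :=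
      (lintegral_frobeniusNormSq_le_three_mul_iteratedFDeriv_one (u t)).trans
        (mul_le_mul_right (hH hs0 hsT hP t ⟨ht.1.le, ht.2.le⟩) 3)
    calc (∫⁻ x, ‖u t x‖ₑ ^ 2) + (∫⁻ x, ENNReal.ofReal (frobeniusNormSq (fderiv ℝ (u t) x)))
        ≤ C + 3 * H := add_le_add hL2 hgrad
      _ = ENNReal.ofReal Ab := by
          rw [hAbdef, ENNReal.ofReal_add ENNReal.toReal_nonneg ENNReal.toReal_nonneg,
            ENNReal.ofReal_toReal hC.ne, ENNReal.ofReal_toReal h3H]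
  -- the initial segment
  have h₁' : ∫⁻ x, ENNReal.ofReal (frobeniusNormSq (fderiv ℝ (u 0) x)) < ⊤ :=
    (lintegral_frobeniusNormSq_le_three_mul_iteratedFDeriv_one (u 0)).trans_lt
      (ENNReal.mul_lt_top (by simp) h₁)
  obtain ⟨T₀, hT₀, hT₀T, hP₀⟩ := exists_strong_pos_initial hc hreg hν hT hsol hfe h₁'
  -- Step 2: the restart with uniform step `τ₂`
  obtain ⟨τ₂, hτ₂, hstep⟩ := strong_pos_restart hc hreg hν hsol hfe hAb
  -- Step 3: induction on the number of restarts
  have hind : ∀ k : ℕ, ∀ ⦃τ : ℝ⦄, 0 < τ → τ < min (T₀ + k * τ₂) T →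
      HasBoundedSobolevNormsOn (Icc τ (min (T₀ + k * τ₂) T)) u := by
    intro k
    induction k with
    | zero =>
      rw [Nat.cast_zero, zero_mul, add_zero, min_eq_left hT₀T]
      exact hP₀
    | succ k ih =>
      by_cases hkT : T₀ + k * τ₂ < T
      · rw [min_eq_left hkT.le] at ih
        have hk0 : 0 < T₀ + k * τ₂ := by positivity
        have h := hstep hk0 hkT ih (hbound hk0 hkT.le ih)
        refine hasBoundedSobolevNormsOn_pos_mono h (le_of_eq ?_)
        push_cast
        ring_nf
      · have hkT' : T ≤ T₀ + k * τ₂ := not_lt.1 hkT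
        rw [min_eq_right hkT'] at ih
        have hk1 : T ≤ T₀ + ((k + 1 : ℕ) : ℝ) * τ₂ := by
          push_cast
          nlinarith
        rwa [min_eq_right hk1]
  obtain ⟨k, hk⟩ : ∃ k : ℕ, T ≤ T₀ + k * τ₂ := by
    obtain ⟨k, hk⟩ := exists_nat_ge (T / τ₂)
    refine ⟨k, ?_⟩
    rw [div_le_iff₀ hτ₂] at hk
    linarith
  have h := hind k
  rwa [min_eq_right hk] at h

/-- **Corollary (closed intervals).** Under the same two facts, a finite energy classical solution
on `[0, T] × ℝ³` with `∇u(0) ∈ L²` has all Sobolev norms bounded on `[τ, T]` for every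
`0 < τ ≤ T`. [cite: Tao2011, Cor. 11.1 + Thm. 5.4 + Prop. 5.6 + Thm. 10.1] -/
theorem hasBoundedSobolevNormsOn_Icc_of_H1 {c : ℝ} (hc : 0 < c) (hreg : TaoH1AlmostRegularWith c)
    (hA : tao2011_enstrophyLocalisation_exterior_apriori)
    {ν T : ℝ} (hν : 0 < ν) (hT : 0 < T)
    {u : ℝ → EuclideanSpace ℝ (Fin 3) → EuclideanSpace ℝ (Fin 3)}
    {p : ℝ → EuclideanSpace ℝ (Fin 3) → ℝ}
    (hsol : IsClassicalNSSolutionOn (Icc 0 T) ν 0 u p)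
    (hfe : ∃ C : ℝ≥0∞, C < ⊤ ∧ ∀ t ∈ Icc 0 T, ∫⁻ x, ‖u t x‖ₑ ^ 2 ≤ C)
    (h₁ : ∫⁻ x, ‖iteratedFDeriv ℝ 1 (u 0) x‖ₑ ^ 2 < ⊤) {τ : ℝ} (hτ0 : 0 < τ) (hτT : τ ≤ T) :
    HasBoundedSobolevNormsOn (Icc τ T) u :=
  hasBoundedSobolevNormsOn_Icc_of_pos (hasBoundedSobolevNormsOn_pos_of_H1 hc hreg hA hν hT hsol hfe h₁)
    hτ0 hτT

/-! ## Step 4: finite energy data — good times, and Prop. 9.1 for the classical class -/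

/-- **Good times.** If `∫_{(0,T)} F < ∞` then every interval `(0, σ)`, `0 < σ ≤ T`, contains a
time `τ` with `F τ < ∞` (otherwise `∫_{(0,σ)} F ≥ ∫_{(0,σ)} ∞ = ∞`). No measurability of `F` is
needed. [folklore] -/
theorem exists_mem_Ioo_lt_top_of_setLIntegral_lt_top {F : ℝ → ℝ≥0∞} {T σ : ℝ}
    (hF : ∫⁻ t in Ioo 0 T, F t < ⊤) (hσ : 0 < σ) (hσT : σ ≤ T) :
    ∃ τ ∈ Ioo 0 σ, F τ < ⊤ := by
  by_contra h
  push Not at h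
  have h1 : ∫⁻ _ in Ioo 0 σ, (⊤ : ℝ≥0∞) ≤ ∫⁻ t in Ioo 0 σ, F t :=
    setLIntegral_mono' measurableSet_Ioo fun τ hτ => h τ hτ
  have h2 : ∫⁻ _ in Ioo 0 σ, (⊤ : ℝ≥0∞) = ⊤ := by
    rw [setLIntegral_const, Real.volume_Ioo, sub_zero, ENNReal.top_mul]
    exact (ENNReal.ofReal_pos.2 hσ).ne'
  have h3 : ∫⁻ t in Ioo 0 σ, F t ≤ ∫⁻ t in Ioo 0 T, F t :=
    lintegral_mono_set (Ioo_subset_Ioo_right hσT)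
  rw [h2] at h1
  exact (lt_irrefl (⊤ : ℝ≥0∞)) ((h1.trans h3).trans_lt hF)

/-- **Finite energy data: strong away from zero.** Under `TaoH1AlmostRegularWith c` (`c > 0`)
and the a priori Thm. 10.1, *every* finite energy classical solution of the unforced system on
`[0, T] × ℝ³`, `ν > 0` (datum merely smooth and in `L²`), lies in `L^∞_t H^k_x([σ, T] × ℝ³)` for
all `k` and all `0 < σ < T`: by Lemma 8.1 (proved) `∫₀ᵀ∫|∇u|² < ∞`, so every `(0, σ)` contains a
good time `τ` with `∇u(τ) ∈ L²`; the translate `u(· + τ)` is a finite energy classical solution on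
`[0, T − τ]` with `H¹` datum, to which `hasBoundedSobolevNormsOn_pos_of_H1` applies, and `[σ, T]` lies inside
`[τ + (σ − τ), T]`. [cite: Tao2011, Cor. 11.1 + Lemma 8.1 + Thm. 5.4 + Prop. 5.6 + Thm. 10.1] -/
theorem hasBoundedSobolevNormsOn_pos_of_finiteEnergy {c : ℝ} (hc : 0 < c) (hreg : TaoH1AlmostRegularWith c)
    (hA : tao2011_enstrophyLocalisation_exterior_apriori)
    {ν T : ℝ} (hν : 0 < ν) (hT : 0 < T)
    {u : ℝ → EuclideanSpace ℝ (Fin 3) → EuclideanSpace ℝ (Fin 3)}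
    {p : ℝ → EuclideanSpace ℝ (Fin 3) → ℝ}
    (hsol : IsClassicalNSSolutionOn (Icc 0 T) ν 0 u p)
    (hfe : ∃ C : ℝ≥0∞, C < ⊤ ∧ ∀ t ∈ Icc 0 T, ∫⁻ x, ‖u t x‖ₑ ^ 2 ≤ C) :
    ∀ ⦃σ : ℝ⦄, 0 < σ → σ < T → HasBoundedSobolevNormsOn (Icc σ T) u := by
  intro σ hσ0 hσT
  obtain ⟨A₀, -, -, -, hgrad⟩ := energyClass_of_finiteEnergy hsol hν hT hfe
  obtain ⟨τ, hτ, hτtop⟩ := exists_mem_Ioo_lt_top_of_setLIntegral_lt_top hgrad hσ0 hσT.le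
  -- the translate `u(· + τ)` on `[0, T - τ]`, with `H¹` datum `u(τ)`
  have hT' : 0 < T - τ := by linarith [hτ.2]
  have hsol' : IsClassicalNSSolutionOn (Icc 0 (T - τ)) ν 0 (fun t => u (t + τ))
      (fun t => p (t + τ)) :=
    (hsol.comp_add_right τ).mono (fun t ht => ⟨by linarith [ht.1, hτ.1], by linarith [ht.2]⟩)
      (uniqueDiffOn_Icc hT')
  have hfe' : ∃ C : ℝ≥0∞, C < ⊤ ∧ ∀ t ∈ Icc 0 (T - τ), ∫⁻ x, ‖u (t + τ) x‖ₑ ^ 2 ≤ C := by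
    obtain ⟨C, hC, hCt⟩ := hfe
    exact ⟨C, hC, fun t ht => hCt (t + τ) ⟨by linarith [ht.1, hτ.1], by linarith [ht.2]⟩⟩
  have h₁' : ∫⁻ x, ‖iteratedFDeriv ℝ 1 (u (0 + τ)) x‖ₑ ^ 2 < ⊤ := by
    rw [zero_add]
    refine lt_of_le_of_lt (lintegral_mono fun x => ?_) hτtop
    rw [enorm_iteratedFDeriv_one]
    exact enorm_sq_fderiv_le_ofReal_frobeniusNormSq _
  have h := hasBoundedSobolevNormsOn_pos_of_H1 hc hreg hA hν hT' hsol' hfe' h₁'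
  have h2 : HasBoundedSobolevNormsOn (Icc (σ - τ) (T - τ)) (fun t => u (t + τ)) :=
    h (by linarith [hτ.2]) (by linarith)
  have h3 := HasBoundedSobolevNormsOn.of_comp_add_right τ h2
  rwa [sub_add_cancel, sub_add_cancel] at h3

/-- **Tao 2011, Prop. 9.1 (bounded total speed, every `ν > 0`) for finite energy classical
solutions on the closed slab, from the almost regular local `H¹` theory and the a priori
Thm. 10.1** — the printed Littlewood–Paley proof (leaf `tao2011_duhamelNonlinearSpeed_unit`) is
replaced by the Foias–Guillopé–Temam/Agmon bound for strong solutions (proved,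
`NSStrongSpeedBound.lean`) and the continuation argument above: the solution is strong on every
`[σ, T]`, `σ > 0` (`hasBoundedSobolevNormsOn_pos_of_finiteEnergy`), so `lintegral_eLpNorm_top_le_of_strong_pos`
applies with the dissipation budget `ν∫₀ᵀ∫|∇u|² ≤ 2c₈E` of Lemma 8.1 (`c₈ = max(1, C₈.₁)`), giving
`∫₀ᵀ‖u‖_{L^∞} ≤ K(ν)(E^{1/2}T^{1/4} + E)` with `K(ν) = K(ν^{-3/4}(2c₈)^{1/2} + 2c₈ν⁻²) + 1`; for
`E = 0` the solution vanishes identically by Lemma 8.1. The statement proved is exactly the tree's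
vendored form `tao2011_boundedTotalSpeed` of Prop. 9.1 (arXiv Prop. 52, p. 27). [cite: Tao2011, Prop. 9.1; RobinsonRodrigoSadowski2016, Lemma 8.15 + Thm. 8.17 + Lemma 6.11 (proof)] -/
theorem tao2011_boundedTotalSpeed_of_almostRegular_of_apriori {c : ℝ} (hc : 0 < c)
    (hreg : TaoH1AlmostRegularWith c) (hA : tao2011_enstrophyLocalisation_exterior_apriori) :
    tao2011_boundedTotalSpeed := by
  obtain ⟨C₈, hC₈top, h81⟩ := tao_finite_energy_smooth_energy_bound_holds
  obtain ⟨K, hK, hspeed⟩ := lintegral_eLpNorm_top_le_of_strong_pos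
  intro ν hν
  -- the constant of Lemma 8.1 as a real number `≥ 1`
  set c₈ : ℝ := max 1 C₈.toReal with hc₈def
  have hc₈1 : 1 ≤ c₈ := le_max_left _ _
  have hc₈0 : 0 < c₈ := one_pos.trans_le hc₈1
  have hC₈le : C₈ ≤ ENNReal.ofReal c₈ := by
    rw [← ENNReal.ofReal_toReal hC₈top.ne]
    exact ENNReal.ofReal_le_ofReal (le_max_right _ _)
  have hν34 : 0 ≤ ν ^ (-(3 / 4 : ℝ)) := Real.rpow_nonneg hν.le _
  set α : ℝ := ν ^ (-(3 / 4 : ℝ)) * Real.sqrt (2 * c₈) with hαdef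
  set β : ℝ := ν⁻¹ ^ 2 * (2 * c₈) with hβdef
  have hα : 0 ≤ α := by positivity
  have hβ : 0 ≤ β := by positivity
  refine ⟨K * (α + β) + 1, by positivity, ?_⟩
  intro T hT u p hsol hfe E hE hE₀
  have hfe' : ∃ A : ℝ≥0∞, A < ⊤ ∧ ∀ t ∈ Icc 0 T, ∫⁻ x, ‖u t x‖ₑ ^ 2 ≤ A := by
    obtain ⟨C', hC'⟩ := hfe
    exact ⟨C', ENNReal.coe_lt_top, hC'⟩
  obtain ⟨h81a, h81b⟩ := h81 ν T hν hT u p hsol hfe'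
  have hkey : C₈ * ∫⁻ x, ‖u 0 x‖ₑ ^ 2 ≤ ENNReal.ofReal (2 * c₈ * E) :=
    calc C₈ * ∫⁻ x, ‖u 0 x‖ₑ ^ 2 ≤ ENNReal.ofReal c₈ * ENNReal.ofReal (2 * E) :=
          mul_le_mul' hC₈le hE₀
      _ = ENNReal.ofReal (2 * c₈ * E) := by
          rw [← ENNReal.ofReal_mul hc₈0.le]
          congr 1
          ring
  rcases hE.eq_or_lt with hE0 | hEpos
  · -- `E = 0`: by Lemma 8.1 the solution vanishes identically on `[0, T]`
    have h0 : C₈ * ∫⁻ x, ‖u 0 x‖ₑ ^ 2 = 0 :=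
      le_zero_iff.1 (hkey.trans (by rw [← hE0, mul_zero, ENNReal.ofReal_zero]))
    have hzero : ∀ t ∈ Icc 0 T, eLpNorm (u t) ∞ volume = 0 := by
      intro t ht
      have h1 : ∫⁻ x, ‖u t x‖ₑ ^ 2 = 0 := le_zero_iff.1 ((h81a t ht).trans h0.le)
      have hmeas : AEMeasurable (fun x => ‖u t x‖ₑ ^ 2) volume :=
        ((hsol.contDiff_velocity ht).continuous.aestronglyMeasurable.enorm.pow_const 2)
      have h2 : (fun x => ‖u t x‖ₑ ^ 2) =ᵐ[volume] 0 := (lintegral_eq_zero_iff' hmeas).1 h1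
      have h3 : u t =ᵐ[volume] 0 := h2.mono fun x hx => by simpa using hx
      rw [eLpNorm_congr_ae h3, eLpNorm_zero]
    calc ∫⁻ t in Ioo 0 T, eLpNorm (u t) ∞ volume = ∫⁻ _ in Ioo 0 T, 0 :=
          setLIntegral_congr_fun measurableSet_Ioo fun t ht => hzero t (Ioo_subset_Icc_self ht)
      _ ≤ _ := by rw [lintegral_zero]; exact zero_le
  · -- `E > 0`: strong away from zero, then the strong-class speed bound
    set E' : ℝ := 2 * c₈ * E with hE'def
    have hE'pos : 0 < E' := by positivity
    have hD : ENNReal.ofReal ν *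
        ∫⁻ t in Ioo 0 T, ∫⁻ x, ENNReal.ofReal (frobeniusNormSq (fderiv ℝ (u t) x)) ≤
          ENNReal.ofReal E' := h81b.trans hkey
    have hP := hasBoundedSobolevNormsOn_pos_of_finiteEnergy hc hreg hA hν hT hsol hfe'
    refine (hspeed hν hT hsol hP hE'pos hD).trans (ENNReal.ofReal_le_ofReal ?_)
    have hsqrt : Real.sqrt E' = Real.sqrt (2 * c₈) * Real.sqrt E := by
      rw [hE'def, Real.sqrt_mul (by positivity)]
    have hT14 : 0 ≤ T ^ (1 / 4 : ℝ) := Real.rpow_nonneg hT.le _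
    have ha : 0 ≤ Real.sqrt E * T ^ (1 / 4 : ℝ) := by positivity
    have hlhs : K * (ν ^ (-(3 / 4 : ℝ)) * Real.sqrt E' * T ^ (1 / 4 : ℝ) + ν⁻¹ ^ 2 * E') =
        K * (α * (Real.sqrt E * T ^ (1 / 4 : ℝ)) + β * E) := by
      rw [hsqrt, hαdef, hβdef, hE'def]
      ring
    rw [hlhs]
    have i1 : 0 ≤ K * β * (Real.sqrt E * T ^ (1 / 4 : ℝ)) := by positivity
    have i2 : 0 ≤ K * α * E := by positivity
    nlinarith

/-! ## Assemblies: Prop. 9.1, Thm. 10.1 and Cor. 11.1/11.4 from the two remaining facts -/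

/-- **Prop. 9.1 at unit viscosity** (the printed leaf `tao2011_boundedTotalSpeed_unit`) from the
almost regular local `H¹` theory and the a priori Thm. 10.1. [cite: Tao2011, Prop. 9.1] -/
theorem tao2011_boundedTotalSpeed_unit_of_almostRegular_of_apriori {c : ℝ} (hc : 0 < c)
    (hreg : TaoH1AlmostRegularWith c) (hA : tao2011_enstrophyLocalisation_exterior_apriori) :
    tao2011_boundedTotalSpeed_unit :=
  tao2011_boundedTotalSpeed_unit_of (tao2011_boundedTotalSpeed_of_almostRegular_of_apriori hc hreg hA)

/-- **Thm. 10.1 (exterior form, every `ν > 0`) from the almost regular local `H¹` theory and the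
a priori Thm. 10.1**: Lemma 8.1 (proved) and Prop. 9.1 (previous theorem) feed the proved assembly
`tao2011_enstrophyLocalisation_exterior_of_parts`. [cite: Tao2011, Thm. 10.1 + Remark 10.6] -/
theorem tao2011_enstrophyLocalisation_exterior_of_almostRegular_of_apriori {c : ℝ} (hc : 0 < c)
    (hreg : TaoH1AlmostRegularWith c) (hA : tao2011_enstrophyLocalisation_exterior_apriori) :
    tao2011_enstrophyLocalisation_exterior :=
  tao2011_enstrophyLocalisation_exterior_of_parts tao_finite_energy_smooth_energy_bound_holds
    (tao2011_boundedTotalSpeed_of_almostRegular_of_apriori hc hreg hA) hA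

/-- **Thm. 10.1 (exterior form) at unit viscosity, as printed** (`tao2011_enstrophyLocalisation_exterior_unit`),
from the almost regular local `H¹` theory and the a priori Thm. 10.1. [cite: Tao2011, Thm. 10.1 + Remark 10.6] -/
theorem tao2011_enstrophyLocalisation_exterior_unit_of_almostRegular_of_apriori {c : ℝ} (hc : 0 < c)
    (hreg : TaoH1AlmostRegularWith c) (hA : tao2011_enstrophyLocalisation_exterior_apriori) :
    tao2011_enstrophyLocalisation_exterior_unit :=
  tao2011_enstrophyLocalisation_exterior_unit_of
    (tao2011_enstrophyLocalisation_exterior_of_almostRegular_of_apriori hc hreg hA)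

/-- **The leaf set of Thm. 10.1 after this file**: the printed Thm. 10.1 at `ν = 1`
(`tao2011_enstrophyLocalisation_exterior_unit`) follows from Tao's local `H¹` theory
(`tao2011_H1_local_almost_regular`, Thm. 5.4 (i)–(ii) + Prop. 5.6) and the annular unit-viscosity
a priori form of Thm. 10.1 (`tao2011_enstrophyLocalisation_annulus_apriori_unit`, Remark 10.6),
through the proved passages annulus → exterior and `ν = 1 → ν > 0`. Prop. 9.1's Littlewood–Paley
proof is no longer on the path. [cite: Tao2011, Thm. 10.1 + Remark 10.6 + Thm. 5.4 + Prop. 5.6] -/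
theorem tao2011_enstrophyLocalisation_exterior_unit_of_almostRegular_of_annulus
    (hreg : tao2011_H1_local_almost_regular)
    (hAnn : tao2011_enstrophyLocalisation_annulus_apriori_unit) :
    tao2011_enstrophyLocalisation_exterior_unit := by
  obtain ⟨c, hc, hreg⟩ := hreg
  exact tao2011_enstrophyLocalisation_exterior_unit_of_almostRegular_of_apriori hc hreg
    (tao2011_enstrophyLocalisation_exterior_apriori_of_annulus_unit hAnn)

/-- **Prop. 9.1 (every `ν > 0`) from the same two leaves.** [cite: Tao2011, Prop. 9.1] -/
theorem tao2011_boundedTotalSpeed_of_almostRegular_of_annulus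
    (hreg : tao2011_H1_local_almost_regular)
    (hAnn : tao2011_enstrophyLocalisation_annulus_apriori_unit) : tao2011_boundedTotalSpeed := by
  obtain ⟨c, hc, hreg⟩ := hreg
  exact tao2011_boundedTotalSpeed_of_almostRegular_of_apriori hc hreg
    (tao2011_enstrophyLocalisation_exterior_apriori_of_annulus_unit hAnn)

/-- **Cor. 11.1 (bounded enstrophy, every `ν > 0`) from the same two leaves** (via
`tao2011_boundedEnstrophy_of_leaves`). [cite: Tao2011, Cor. 11.1] -/
theorem tao2011_boundedEnstrophy_of_almostRegular_of_annulus
    (hreg : tao2011_H1_local_almost_regular)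
    (hAnn : tao2011_enstrophyLocalisation_annulus_apriori_unit) : tao2011_boundedEnstrophy := by
  obtain ⟨c, hc, hreg⟩ := hreg
  have hA := tao2011_enstrophyLocalisation_exterior_apriori_of_annulus_unit hAnn
  exact tao2011_boundedEnstrophy_of_leaves tao_finite_energy_smooth_energy_bound_holds
    (tao2011_boundedTotalSpeed_of_almostRegular_of_apriori hc hreg hA) hA

/-- **Cor. 11.4 (unconditional uniqueness: as printed, velocity form, and the duplicate vendoring)
from the same two leaves** (via `tao_unconditional_uniqueness_of_leaves`, the `B`-side
Cor. 4.3 + Thm. 5.4 (iii) being the proved `tao2011_velocity_eq_of_memSobolevX_holds`). [cite: Tao2011, Cor. 11.4 (Remark 11.3)] -/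
theorem tao_unconditional_uniqueness_of_almostRegular_of_annulus
    (hreg : tao2011_H1_local_almost_regular)
    (hAnn : tao2011_enstrophyLocalisation_annulus_apriori_unit) :
    tao_unconditional_uniqueness ∧ tao_unconditional_uniqueness_velocity ∧
      tao_finite_energy_velocity_uniqueness := by
  obtain ⟨c, hc, hreg⟩ := hreg
  have hA := tao2011_enstrophyLocalisation_exterior_apriori_of_annulus_unit hAnn
  exact tao_unconditional_uniqueness_of_leaves tao_finite_energy_smooth_energy_bound_holds
    (tao2011_boundedTotalSpeed_of_almostRegular_of_apriori hc hreg hA) hA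
    tao2011_velocity_eq_of_memSobolevX_holds

/-- **`tao2011_hasBoundedSobolevNormsOn` (Cor. 11.1 + Cor. 4.3 + Thm. 5.4 (iv): Schwartz data, all
Sobolev norms bounded on `[0, T]`) from the same two leaves**, via the existing assembly
`tao2011_hasBoundedSobolevNormsOn_of_apriori_leaves` fed with Prop. 9.1 from this file. [cite: Tao2011, Cor. 11.1 + Cor. 4.3 + Thm. 5.4 (iv)] -/
theorem tao2011_hasBoundedSobolevNormsOn_of_almostRegular_of_annulus
    (hreg : tao2011_H1_local_almost_regular)
    (hAnn : tao2011_enstrophyLocalisation_annulus_apriori_unit) :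
    tao2011_hasBoundedSobolevNormsOn := by
  obtain ⟨c, hc, hreg⟩ := hreg
  have hA := tao2011_enstrophyLocalisation_exterior_apriori_of_annulus_unit hAnn
  exact tao2011_hasBoundedSobolevNormsOn_of_apriori_leaves tao_finite_energy_smooth_energy_bound_holds
    (tao2011_boundedTotalSpeed_of_almostRegular_of_apriori hc hreg hA) hA

end Literature.Analysis.FluidPDE

end
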